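import Summits.BirchSwinnertonDyer.BirchSwinnertonDyer.Theorems.GenusKolyvaginAtTwoGenusPrimitiveSupplyAtTwoDoorFieldParity
import Summits.BirchSwinnertonDyer.BirchSwinnertonDyer.Theorems.GenusKolyvaginAtTwoGenusPrimitiveSupplyAtTwoPrimeTwistEggBit
import HarnessLib

/-!
# Route `GenusKolyvaginAtTwo`, crux #2 `GenusPrimitiveSupplyAtTwo` (stmt-BirchSwinnertonDyer-22136):
# `Ш(W)[2]` A PLANE, `W` OF RANK `0`, AT A DOOR WHOSE TWIST HAS RANK `1` — the twin's generator is forced OFF the egg,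
# `#Sel₂(W_K/K) ∈ {4, 8}` unconditionally, and DESC-28-X `F1Sign2.ShaPlaneDoorTwinIdentityAtTwo` BY NAME behind `h14`

Width seat `bsd-line-gk2-p5` g18 (cell `bsd-f1-sign2`, SUPPLY lineage of crux 22136), file 53 of the series; sequel of files 51/52. THEOREMS ONLY
(no definition, no new named fact, no `sorry`); helper `--supports stmt-BirchSwinnertonDyer-22136`; no item is closed; BSD is not proved by any of this.

WHAT. The configuration of -desc's DESC-28-X (census population X = X5 rank `0`): `W/ℚ` globally minimal, `Δ_W > 0`, `E(ℚ)[2] = 0`,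
`rank W(ℚ) = 0`, `#Ш(W)[2] = 4`; `d` descent-admissible with `rank W^{(d)}(ℚ) = 1` and `Ш(W^{(d)})[2] = 0`; `K ∋ √d` quadratic. This is the
`Δ > 0` shadow of the route's own frame (rank-`0` curve, rank-`1` `2`-Selmer-minimal twin).

* §219 **Kramer's Thm. 1 as a COUNT SKELETON, unconditional and rank-free** (`natCard_selmerGroup_baseChange_two_eq_relaxed_mul`): for `W` globally
  minimal with `E(ℚ)[2] = 0`, `d` descent-admissible, `K ∋ √d`: `#Sel₂(W_K/K) = #Sel₂^{rel ∞}(W) · r` with `r` a power of `2`,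
  `r ≤ #Sel₂^{str ∞}(W)` — the endomorphism `m ↦ m + σ₀ m` of `M = Sel₂(W_K/K)` has kernel `M^{σ₀} = res_K Sel₂^{rel ∞}(W)` (file 50) and image
  inside `res_K Sel₂^{str ∞}(W)` (files 48/49). File 51 §214 was the instance `#Sel₂^{rel ∞} = 4`, `#Sel₂^{str ∞} = 2`.
* §220 the X-configuration, UNCONDITIONALLY: `#Sel₂(W) = 4`, `#Sel₂(W^{(d)}) = 2`; the prime-twist dictionary (files 39–41) DECIDES the
  archimedean bit (else `#Sel_𝔓(A_χ) = 2·#Sel₂(W) = 8 ≠ 2`): some class of `Ш(W)[2]` is non-trivial at `∞`, `Sel_𝔓(A_χ) = Sel₂^{str ∞}(W)` has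
  order `2`, `Sel₂^{rel ∞}(W)` order `4`; the Kummer class of an egg point of `W^{(d)}`, transported along `ψ_*` (file 43's `GaloisImage` transport),
  would be a class of `Sel₂^{str ∞}(W)` non-trivial at `∞` — so **`W^{(d)}(ℚ)` MISSES THE EGG** (`not_meetsEgg_quadraticTwist_of_shaPlane`, no `h14`);
  and §219 gives **`#Sel₂(W_K/K) ∈ {4, 8}`**, `#Ш(W_K/K)[2] ∈ {2, 4}`.
* §221 behind `h14` (the tree's named fact `Monsky1996_lemma14b_twoSelmerRank_parity` = Kramer Thm. 1 parity + Thm. 2, NOT proved here):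
  **`#Sel₂(W_K/K) = 8`, `#Ш(W_K/K)[2] = 4`**, **`shaPlaneDoorTwinIdentityAtTwo_of_monsky : … → F1Sign2.ShaPlaneDoorTwinIdentityAtTwo`** (DESC-28-X
  BY NAME); its `h14`-free half is `not_meetsEgg_doorTwist_of_shaPlane`.

Honest framing: Kramer 1981 Thm. 1 / Prop. 6 / Prop. 7 bookkeeping (finiteness-free) plus, for the last bit only, `h14`; kernel-new; beyond-print
theorem: no. Crux 22136 stays OPEN exactly at (U) 24947 ∧ (CONV₂) 19220/24948. BSD is not proved by any of this.
References: [Kramer1981] Thm. 1, Prop. 6, Prop. 7, Thm. 2; [MazurRubin2007] §3, Prop. 4.1; [MazurRubin2010] Lemma 3.2; [Monsky1996] Lemma 1.4(b).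
-/

set_option linter.dupNamespace false -- tree convention: `Summit.BirchSwinnertonDyer.BirchSwinnertonDyer.Theorems` (summit = sub-problem)
set_option autoImplicit false

noncomputable section

open scoped Classical AddSubgroup

namespace Summit.BirchSwinnertonDyer.BirchSwinnertonDyer.Theorems.GenusKolyArch

open WeierstrassCurve NumberField IsDedekindDomain Field
open Literature.NumberTheory.EllipticCurves Literature.NumberTheory.GaloisRepresentations
open Summit.BirchSwinnertonDyer.Rank1Residual.X11b.KummerPT (kummerStrict)
open Summit.BirchSwinnertonDyer.Rank1Residual.F1Sign2 (selmerGroupRelaxedAtInfinityAtTwo DescAdmissible NoRationalTwoTorsion MeetsEgg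
  selmerTwoCard twistSelmerTwoCard shaTwoCard IsDoorField fieldSelmerTwoCard doorTwist IsQuadraticCharacterOf)
open Literature.NumberTheory.EllipticCurves.Greenberg1999 (HasRationalTwoTorsionX)

/-! ## §219 Kramer's Theorem 1 as a count skeleton: `#Sel₂(W_K/K) = #Sel₂^{rel ∞}(W) · r`, `r ≤ #Sel₂^{str ∞}(W)` a power of `2` -/

section Skeleton

variable (W : WeierstrassCurve ℚ) [W.IsElliptic] [W.IsGloballyMinimal] (K : Type) [Field K] [NumberField K]

/-- **Kramer's Thm. 1 as a COUNT SKELETON (unconditional, rank-free)**: for `W/ℚ` globally minimal with `E(ℚ)[2] = 0`, `d` descent-admissible and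
`K ∋ √d` quadratic, `#Sel₂(W_K/K) = #Sel₂^{rel ∞}(W) · r` for some power of two `r ≤ #Sel₂^{str ∞}(W)`: the map `m ↦ m + σ₀m` on `M = Sel₂(W_K/K)` has
KERNEL `M^{σ₀} = res_K Sel₂^{rel ∞}(W)` (file 50 `mem_selmerGroup_and_conjAct_eq_iff_exists_mem_relaxed`, `res_K` injective) and IMAGE inside
`res_K Sel₂^{str ∞}(W)` (`m + σ₀m = res_K(cor m)`, `cor m` trivial at `∞` by file 48 and `∞`-relaxed Selmer by file 49). [cite: Kramer1981, Thm. 1, Prop. 7]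
[cite: SerreGaloisCohomology1997, I §2.4] -/
theorem natCard_selmerGroup_baseChange_two_eq_relaxed_mul (hT : NoRationalTwoTorsion W) {d : ℤ} (hd : DescAdmissible W d)
    (h2 : Module.finrank ℚ K = 2) {i : K} (hi : i ^ 2 = (d : K)) :
    ∃ r : ℕ, (∃ a : ℕ, r = 2 ^ a) ∧ r ≤ Nat.card ((kummerStrict W 2 {(Sum.inl Rat.infinitePlace : Place ℚ)}).selmerGroup) ∧
      Nat.card ((W.baseChange K).selmerGroup ((2 : ℕ) : ℤ)) = Nat.card (selmerGroupRelaxedAtInfinityAtTwo W) * r := by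
  have hdneg : d < 0 := hd.1
  haveI : (W.baseChange K).IsElliptic := inferInstanceAs ((W.map (algebraMap ℚ K)).IsElliptic)
  haveI : IsGalois ℚ K := isGalois_of_finrank_eq_two K h2
  have hK : ∀ w : InfinitePlace K, w.IsComplex := infinitePlace_isComplex_of_sq_eq_intCast hi hdneg
  have hθ : i ∉ Set.range (algebraMap ℚ K) := by
    rintro ⟨q, hq⟩
    have hq2 : algebraMap ℚ K (q ^ 2) = algebraMap ℚ K (d : ℚ) := by rw [map_pow, hq, hi, map_intCast]
    have hq2' : q ^ 2 = (d : ℚ) := (algebraMap ℚ K).injective hq2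
    have hd' : (d : ℚ) < 0 := by exact_mod_cast hdneg
    nlinarith [sq_nonneg q]
  have hc' : i ^ 2 = algebraMap ℚ K (d : ℚ) := by rw [hi, map_intCast]
  set σ₀ : K ≃ₐ[ℚ] K := sigmaQ K h2 hθ hc' with hσ₀
  have hσ₀1 : σ₀ ≠ 1 := sigmaQ_ne_one K h2 hθ hc'
  have h2t' : ∀ P : (W.baseChange K).toAffine.Point, ((2 : ℕ) : ℤ) • P = 0 → P = 0 := fun P hP ↦
    Summit.BirchSwinnertonDyer.Rank1Residual.F1Sign2.EggDoubling.eq_zero_of_two_smul_eq_zero_baseChange W hT h2 P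
      (by rwa [natCast_zsmul] at hP)
  have hinj := GenusExact.EigenClassesFinite.resTorsion_injective_of_noTorsion W K h2 hθ hc' ((2 : ℕ) : ℤ) h2t'
  set S : AddSubgroup (galH1Torsion (W.baseChange K) ((2 : ℕ) : ℤ)) := (W.baseChange K).selmerGroup ((2 : ℕ) : ℤ) with hS
  haveI : Finite S := finite_selmerGroup_holds (W.baseChange K) (by norm_num)
  -- the map `m ↦ m + σ₀ m`
  let g : S →+ galH1Torsion (W.baseChange K) ((2 : ℕ) : ℤ) :=
    (AddMonoidHom.id _ + conjAct W σ₀ ((2 : ℕ) : ℤ)).comp S.subtype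
  have hg : ∀ m : S, g m = (m : galH1Torsion (W.baseChange K) ((2 : ℕ) : ℤ)) + conjAct W σ₀ _ m := fun m ↦ rfl
  have h2m : ∀ m : galH1Torsion (W.baseChange K) ((2 : ℕ) : ℤ), m + m = 0 := fun m ↦ by
    rw [← two_nsmul, ← natCast_zsmul]
    exact zsmul_discreteH1_torsion ((2 : ℕ) : ℤ) m
  have hker_iff : ∀ m : S, m ∈ g.ker ↔ conjAct W σ₀ _ (m : galH1Torsion (W.baseChange K) ((2 : ℕ) : ℤ)) = m := by
    intro m
    rw [AddMonoidHom.mem_ker, hg]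
    constructor
    · intro h
      have h1 := eq_neg_of_add_eq_zero_right h
      rw [h1, neg_eq_iff_add_eq_zero, h2m]
    · intro h
      rw [h, h2m]
  -- `#S = #ker · #range`
  have hcard : Nat.card S = Nat.card g.ker * Nat.card g.range := by
    rw [← AddSubgroup.index_ker, AddSubgroup.card_mul_index]
  -- `#ker = #Sel₂^{rel ∞}(W)`
  have hker : Nat.card g.ker = Nat.card (selmerGroupRelaxedAtInfinityAtTwo W) := by
    symm
    refine Nat.card_eq_of_bijective
      (fun x : selmerGroupRelaxedAtInfinityAtTwo W ↦
        (⟨⟨resTorsion W K _ x.1, (resTorsion_mem_selmerGroup_iff_mem_selmerGroupRelaxedAtInfinityAtTwo W K hd h2 hi x.1).mpr x.2⟩,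
          (hker_iff _).mpr (conjAct_resTorsion K W _ σ₀ h2 hσ₀1 x.1)⟩ : g.ker)) ⟨?_, ?_⟩
    · intro x y hxy
      exact Subtype.ext (hinj (congrArg (fun z : g.ker ↦ ((z : S) : galH1Torsion (W.baseChange K) ((2 : ℕ) : ℤ))) hxy))
    · rintro ⟨m, hm⟩
      obtain ⟨x, hx, hxm⟩ := (mem_selmerGroup_and_conjAct_eq_iff_exists_mem_relaxed W K hT hd h2 hi hσ₀1 m.1).mp
        ⟨m.2, (hker_iff m).mp hm⟩
      exact ⟨⟨x, hx⟩, Subtype.ext (Subtype.ext hxm)⟩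
  -- `#range ≤ #Sel₂^{str ∞}(W)`
  haveI : Finite (W.selmerGroup ((2 : ℕ) : ℤ)) := finite_selmerGroup_holds W (by norm_num)
  haveI : Finite ((kummerStrict W 2 {(Sum.inl Rat.infinitePlace : Place ℚ)}).selmerGroup) :=
    Finite.of_injective
      (fun c : (kummerStrict W 2 {(Sum.inl Rat.infinitePlace : Place ℚ)}).selmerGroup ↦
        (⟨c.1, selmerGroup_kummerStrict_singleton_inl_le_selmerGroup W Rat.infinitePlace c.2⟩ : W.selmerGroup ((2 : ℕ) : ℤ)))
      (fun x y h ↦ by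
        have h' := congrArg Subtype.val h
        exact Subtype.ext h')
  haveI : Finite g.range := Finite.of_surjective (fun m : S ↦ (⟨g m, ⟨m, rfl⟩⟩ : g.range))
    (fun z ↦ by obtain ⟨z, m, hm⟩ := z; exact ⟨m, Subtype.ext hm⟩)
  have hlift : ∀ z : g.range, ∃ y : W.galH1Torsion ((2 : ℕ) : ℤ),
      y ∈ (kummerStrict W 2 {(Sum.inl Rat.infinitePlace : Place ℚ)}).selmerGroup ∧
        resTorsion W K ((2 : ℕ) : ℤ) y = (z : galH1Torsion (W.baseChange K) ((2 : ℕ) : ℤ)) := by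
    rintro ⟨z, m, rfl⟩
    obtain ⟨y, hy, hy0⟩ :=
      exists_resTorsion_eq_add_conjAct_and_localization_inl_eq_zero_of_sq_eq_intCast W K h2 hσ₀1 hi hdneg ((2 : ℕ) : ℤ) m
    have hyS : resTorsion W K _ y ∈ S := by
      rw [hy]
      exact S.add_mem m.2 (conjAct_mem_selmerGroup W hK σ₀ _ m.2)
    have hyR := mem_selmerGroupRelaxedAtInfinityAtTwo_of_resTorsion_mem_selmerGroup W K hd h2 hi hyS
    exact ⟨y, (mem_selmerGroup_kummerStrict_singleton_inl_iff W Rat.infinitePlace y).mpr ⟨hyR, hy0⟩, hy⟩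
  have hrange : Nat.card g.range ≤ Nat.card ((kummerStrict W 2 {(Sum.inl Rat.infinitePlace : Place ℚ)}).selmerGroup) := by
    refine Nat.card_le_card_of_injective
      (fun z ↦ (⟨Classical.choose (hlift z), (Classical.choose_spec (hlift z)).1⟩ :
        (kummerStrict W 2 {(Sum.inl Rat.infinitePlace : Place ℚ)}).selmerGroup)) fun z₁ z₂ h ↦ ?_
    have h' : Classical.choose (hlift z₁) = Classical.choose (hlift z₂) := congrArg Subtype.val h
    apply Subtype.ext
    rw [← (Classical.choose_spec (hlift z₁)).2, ← (Classical.choose_spec (hlift z₂)).2, h']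
  -- `#range` is a power of `2` (the range is killed by `2`)
  haveI : Fact (Nat.Prime 2) := ⟨Nat.prime_two⟩
  obtain ⟨a, ha⟩ := exists_natCard_eq_pow_of_nsmul_eq_zero (G := g.range) 2 fun z ↦ Subtype.ext (by
    change (2 : ℕ) • (z : galH1Torsion (W.baseChange K) ((2 : ℕ) : ℤ)) = 0
    rw [two_nsmul, h2m])
  exact ⟨Nat.card g.range, ⟨a, ha⟩, hrange, by rw [hcard, hker]⟩

end Skeleton

/-! ## §220 The X-configuration, unconditionally: the twin's generator is off the egg; `#Sel₂(W_K/K) ∈ {4, 8}` -/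

section ShaPlane

variable (W : WeierstrassCurve ℚ) [W.IsElliptic] [W.IsGloballyMinimal]

omit [W.IsGloballyMinimal] in
/-- Descent count: `rank W(ℚ) = 0`, `E(ℚ)[2] = 0`, `#Ш(W)[2] = 4` ⟹ `#Sel₂(W) = 4`. [cite: SilvermanAEC2009, Thm X.4.2(a)] -/
theorem selmerTwoCard_eq_four_of_rank_zero_of_shaTwoCard_eq_four (hT : NoRationalTwoTorsion W) (hrank : W.mordellWeilRank = 0)
    (hsha : shaTwoCard W = 4) : selmerTwoCard W = 4 := by
  have hinst : (instDecidableEqRat : DecidableEq ℚ) = fun a b => Classical.propDecidable (a = b) := Subsingleton.elim _ _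
  have ht : Nat.card (AddSubgroup.torsionBy W.toAffine.Point ((2 : ℕ) : ℤ)) = 1 := by
    have hbot : AddSubgroup.torsionBy W.toAffine.Point ((2 : ℕ) : ℤ) = ⊥ :=
      (AddSubgroup.eq_bot_iff_forall _).mpr fun P hP ↦
        Summit.BirchSwinnertonDyer.Rank1Residual.F1Sign2.EggDoubling.eq_zero_of_two_smul_eq_zero W hT P
          (AddSubgroup.torsionBy.nsmul_iff.mp hP)
    rw [hbot, AddSubgroup.card_bot]
  rw [hinst] at ht
  have h := card_selmerGroup_eq_pow_rank_mul W 2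
  unfold shaTwoCard at hsha
  rw [ht, hsha, hrank, mul_one, pow_zero, Nat.cast_ofNat] at h
  exact h

omit [W.IsElliptic] [W.IsGloballyMinimal] in
/-- `E^{(d)}(ℚ)[2] = 0` when `E(ℚ)[2] = 0` (`d ≠ 0`): the `2`-division cubics have the same splitting field. [cite: SilvermanAEC2009, X.5.4] -/
theorem noRationalTwoTorsion_quadraticTwist (hT : NoRationalTwoTorsion W) {d : ℚ} (hd : d ≠ 0) :
    NoRationalTwoTorsion (W.quadraticTwist d) := by
  intro x hx
  obtain ⟨x', hx'⟩ := (exists_hasRationalTwoTorsionX_quadraticTwist_iff W hd).mp ⟨x, hx⟩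
  exact hT x' hx'

omit [W.IsGloballyMinimal] in
/-- Descent count for the twist: `rank W^{(d)}(ℚ) = 1`, `Ш(W^{(d)})[2] = 0`, `E(ℚ)[2] = 0` ⟹ `#Sel₂(W^{(d)}) = 2`. [cite: SilvermanAEC2009, Thm X.4.2(a)] -/
theorem twistSelmerTwoCard_eq_two_of_rank_one_of_shaTwoCard_eq_one (hT : NoRationalTwoTorsion W) {d : ℤ} (hd0 : d ≠ 0)
    (hrank : (W.quadraticTwist (d : ℚ)).mordellWeilRank = 1) (hsha : shaTwoCard (W.quadraticTwist (d : ℚ)) = 1) :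
    twistSelmerTwoCard W d = 2 := by
  have hd0' : ((d : ℤ) : ℚ) ≠ 0 := Int.cast_ne_zero.mpr hd0
  haveI : (W.quadraticTwist (d : ℚ)).IsElliptic := W.isElliptic_quadraticTwist hd0'
  have hTV : NoRationalTwoTorsion (W.quadraticTwist (d : ℚ)) := noRationalTwoTorsion_quadraticTwist W hT hd0'
  have hinst : (instDecidableEqRat : DecidableEq ℚ) = fun a b => Classical.propDecidable (a = b) := Subsingleton.elim _ _
  have ht : Nat.card (AddSubgroup.torsionBy (W.quadraticTwist (d : ℚ)).toAffine.Point ((2 : ℕ) : ℤ)) = 1 := by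
    have hbot : AddSubgroup.torsionBy (W.quadraticTwist (d : ℚ)).toAffine.Point ((2 : ℕ) : ℤ) = ⊥ :=
      (AddSubgroup.eq_bot_iff_forall _).mpr fun P hP ↦
        Summit.BirchSwinnertonDyer.Rank1Residual.F1Sign2.EggDoubling.eq_zero_of_two_smul_eq_zero _ hTV P
          (AddSubgroup.torsionBy.nsmul_iff.mp hP)
    rw [hbot, AddSubgroup.card_bot]
  rw [hinst] at ht
  have h := card_selmerGroup_eq_pow_rank_mul (W.quadraticTwist (d : ℚ)) 2
  unfold shaTwoCard at hsha
  rw [ht, hsha, hrank, mul_one, pow_one, mul_one, Nat.cast_ofNat] at h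
  exact h

/-- **In the X-configuration SOME `2`-Selmer class of `W` (i.e. of `Ш(W)[2]`) is non-trivial at `∞`** — decided by the prime-twist dictionary:
otherwise `Sel_𝔓(A_χ) = Sel₂^{rel ∞}(W)` would have order `2·#Sel₂(W) = 8` (file 40 §180), but `#Sel_𝔓(A_χ) = #Sel₂(W^{(d)}) = 2`.
[cite: Kramer1981, Prop. 6, Thm. 1] [cite: MazurRubin2010, Lemma 3.2, Prop 3.3] -/
theorem exists_mem_selmerGroup_localization_inl_ne_zero_of_shaPlane (hΔ : 0 < W.Δ) (hT : NoRationalTwoTorsion W)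
    (hrank : W.mordellWeilRank = 0) (hsha : shaTwoCard W = 4) {d : ℤ} (hd : DescAdmissible W d)
    (hrank1 : (W.quadraticTwist (d : ℚ)).mordellWeilRank = 1) (hsha1 : shaTwoCard (W.quadraticTwist (d : ℚ)) = 1) :
    ∃ c ∈ W.selmerGroup ((2 : ℕ) : ℤ),
      galoisCohomology.localization (W.torsionGaloisModule ((2 : ℕ) : ℤ)) (Sum.inl Rat.infinitePlace) 1 c ≠ 0 := by
  have hd0 : d ≠ 0 := hd.1.ne
  obtain ⟨χ, hχ⟩ := GenusKolyTransp.quadraticCharacterExists_holds d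
  have hS4 := selmerTwoCard_eq_four_of_rank_zero_of_shaTwoCard_eq_four W hT hrank hsha
  have hS2 := twistSelmerTwoCard_eq_two_of_rank_one_of_shaTwoCard_eq_one W hT hd0 hrank1 hsha1
  by_contra hnot
  push Not at hnot
  have h := (natCard_primeTwist_selmerGroup_eq_of_infinity_bit W hΔ hT hd hχ Rat.infinitePlace).1 hnot
  rw [natCard_primeTwist_selmerGroup_eq_twistSelmerTwoCard W hd0 hχ, hS2, hS4] at h
  omega

/-- **In the X-configuration `#Sel₂^{str ∞}(W) = 2` and `#Sel₂^{rel ∞}(W) = 4`**: `Sel_𝔓(A_χ) = Sel₂^{str ∞}(W)` (file 41 §182, from the class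
non-trivial at `∞`) has order `#Sel₂(W^{(d)}) = 2`, and `[Sel₂^{rel ∞} : Sel₂^{str ∞}] = 2` (file 28). [cite: Kramer1981, Prop. 6, Thm. 1]
[cite: MazurRubin2010, Lemma 3.2] -/
theorem natCard_kummerStrict_eq_two_and_natCard_relaxed_eq_four_of_shaPlane (hΔ : 0 < W.Δ) (hT : NoRationalTwoTorsion W)
    (hrank : W.mordellWeilRank = 0) (hsha : shaTwoCard W = 4) {d : ℤ} (hd : DescAdmissible W d)
    (hrank1 : (W.quadraticTwist (d : ℚ)).mordellWeilRank = 1) (hsha1 : shaTwoCard (W.quadraticTwist (d : ℚ)) = 1) :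
    Nat.card ((kummerStrict W 2 {(Sum.inl Rat.infinitePlace : Place ℚ)}).selmerGroup) = 2 ∧
      Nat.card (selmerGroupRelaxedAtInfinityAtTwo W) = 4 := by
  have hd0 : d ≠ 0 := hd.1.ne
  obtain ⟨χ, hχ⟩ := GenusKolyTransp.quadraticCharacterExists_holds d
  have hex := exists_mem_selmerGroup_localization_inl_ne_zero_of_shaPlane W hΔ hT hrank hsha hd hrank1 hsha1
  have hstr := primeTwist_selmerGroup_eq_kummerStrict_of_exists_localization_ne_zero W hΔ hd hχ Rat.infinitePlace hex
  have hS2 := twistSelmerTwoCard_eq_two_of_rank_one_of_shaTwoCard_eq_one W hT hd0 hrank1 hsha1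
  rw [← natCard_primeTwist_selmerGroup_eq_twistSelmerTwoCard W hd0 hχ, hstr] at hS2
  have hS2' : Nat.card ((kummerStrict W 2 {(Sum.inl Rat.infinitePlace : Place ℚ)}).selmerGroup) = 2 := hS2
  refine ⟨hS2', ?_⟩
  have hidx := relIndex_kummerStrict_selmerGroupRelaxedAtInfinityAtTwo_eq_two_of_Δ_pos W hΔ Rat.infinitePlace
  have hle : (kummerStrict W 2 {(Sum.inl Rat.infinitePlace : Place ℚ)}).selmerGroup ≤ selmerGroupRelaxedAtInfinityAtTwo W :=
    (selmerGroup_kummerStrict_singleton_inl_le_selmerGroup W _).trans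
      (Summit.BirchSwinnertonDyer.Rank1Residual.F1Sign2.selmerGroup_le_selmerGroupRelaxedAtInfinityAtTwo W)
  have h : Nat.card ((kummerStrict W 2 {(Sum.inl Rat.infinitePlace : Place ℚ)}).selmerGroup) * 2 =
      Nat.card (selmerGroupRelaxedAtInfinityAtTwo W) := by
    have h0 := natCard_mul_relIndex_eq_natCard hle
    rwa [hidx] at h0
  rw [hS2'] at h
  omega

/-- **In the X-configuration the twin's Mordell–Weil group MISSES THE EGG** (`¬ MeetsEgg W^{(d)}`, first conjunct of DESC-28-X, no `h14`): the Kummer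
class of an egg point of `W^{(d)}` is a `2`-Selmer class non-trivial at `∞` (file 30); along the dictionary `ψ_* : H¹(ℚ, W^{(d)}[2]) ⥲ H¹(ℚ, W[2])`
(files 39/40, zero-restriction transported by `GaloisImage.VisibleIndependence.res_h1Equiv_eq_zero_iff`) it lands in `Sel_𝔓(A_χ) = Sel₂^{str ∞}(W)`,
whose classes are TRIVIAL at `∞` — contradiction. (Kramer: `Φ = ker(loc_∞ | Sel₂ W)` is a non-zero subspace of the line `Sel₂(W^{(d)})`.)
[cite: Kramer1981, Prop. 6, Prop. 7, Thm. 1] [cite: MazurRubin2007, §3, Prop 4.1 and Def 4.3] -/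
theorem not_meetsEgg_quadraticTwist_of_shaPlane (hΔ : 0 < W.Δ) (hT : NoRationalTwoTorsion W)
    (hrank : W.mordellWeilRank = 0) (hsha : shaTwoCard W = 4) {d : ℤ} (hd : DescAdmissible W d)
    (hrank1 : (W.quadraticTwist (d : ℚ)).mordellWeilRank = 1) (hsha1 : shaTwoCard (W.quadraticTwist (d : ℚ)) = 1) :
    ¬ MeetsEgg (W.quadraticTwist (d : ℚ)) := by
  intro hegg
  have hd0 : d ≠ 0 := hd.1.ne
  have hd0' : ((d : ℤ) : ℚ) ≠ 0 := Int.cast_ne_zero.mpr hd0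
  haveI : (W.quadraticTwist (d : ℚ)).IsElliptic := W.isElliptic_quadraticTwist hd0'
  obtain ⟨χ, hχ⟩ := GenusKolyTransp.quadraticCharacterExists_holds d
  set V : WeierstrassCurve ℚ := W.quadraticTwist (d : ℚ) with hV
  -- the dictionary for the model `V` (`C = 1`)
  obtain ⟨ψ, hψ, Φ, hΦ, -, hSel, -⟩ := exists_primeTwistModel_selmerGroup_sha_iff W hd0' (one_smul _ (W.quadraticTwist (d : ℚ))) χ
    (smul_geomSqrt_iff_of_isQuadraticCharacterOf hχ)
  -- an egg point of `V` gives a `2`-Selmer class of `V` non-trivial at `∞`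
  obtain ⟨c, hc, hcne⟩ := exists_mem_selmerGroup_localization_inl_ne_zero_of_meetsEgg V hegg
  have hc' : c ∈ V.selmerGroup ((2 : ℕ) : ℤ) := (SetLike.ext_iff.mp (V.selmerGroup_eq_selmerGroup_kummerSelmerStructure _) c).mpr hc
  -- its transport lies in `Sel_𝔓(A_χ) = Sel₂^{str ∞}(W)`, hence is trivial at `∞`
  have hx : h1Equiv ψ hψ c ∈ PrimeTwist.selmerGroup W χ := (hSel c).mp hc'
  have hex := exists_mem_selmerGroup_localization_inl_ne_zero_of_shaPlane W hΔ hT hrank hsha hd hrank1 hsha1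
  rw [primeTwist_selmerGroup_eq_kummerStrict_of_exists_localization_ne_zero W hΔ hd hχ Rat.infinitePlace hex] at hx
  have hx0 := ((mem_selmerGroup_kummerStrict_singleton_inl_iff W Rat.infinitePlace _).mp hx).2
  -- transport back: `loc_∞ (ψ_* c) = 0 ↔ loc_∞ c = 0`
  have htr : galoisCohomology.localization (W.torsionGaloisModule ((2 : ℕ) : ℤ)) (Sum.inl Rat.infinitePlace) 1 (h1Equiv ψ hψ c) = 0 ↔
      galoisCohomology.localization (V.torsionGaloisModule ((2 : ℕ) : ℤ)) (Sum.inl Rat.infinitePlace) 1 c = 0 :=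
    Summit.BirchSwinnertonDyer.Rank1Residual.GaloisImage.VisibleIndependence.res_h1Equiv_eq_zero_iff W V ψ hψ _ _
  exact hcne (htr.mp hx0)

variable (K : Type) [Field K] [NumberField K]

/-- **In the X-configuration `#Sel₂(W_K/K) ∈ {4, 8}` unconditionally** (`K ∋ √d`): §219 with `#Sel₂^{rel ∞}(W) = 4`, `#Sel₂^{str ∞}(W) = 2`.
[cite: Kramer1981, Thm. 1, Prop. 6, Prop. 7] -/
theorem natCard_selmerGroup_baseChange_two_eq_four_or_eq_eight_of_shaPlane (hΔ : 0 < W.Δ) (hT : NoRationalTwoTorsion W)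
    (hrank : W.mordellWeilRank = 0) (hsha : shaTwoCard W = 4) {d : ℤ} (hd : DescAdmissible W d)
    (hrank1 : (W.quadraticTwist (d : ℚ)).mordellWeilRank = 1) (hsha1 : shaTwoCard (W.quadraticTwist (d : ℚ)) = 1)
    (h2 : Module.finrank ℚ K = 2) {i : K} (hi : i ^ 2 = (d : K)) :
    Nat.card ((W.baseChange K).selmerGroup ((2 : ℕ) : ℤ)) = 4 ∨ Nat.card ((W.baseChange K).selmerGroup ((2 : ℕ) : ℤ)) = 8 := by
  obtain ⟨r, ⟨a, rfl⟩, hr, hcount⟩ := natCard_selmerGroup_baseChange_two_eq_relaxed_mul W K hT hd h2 hi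
  obtain ⟨hstr, hrel⟩ := natCard_kummerStrict_eq_two_and_natCard_relaxed_eq_four_of_shaPlane W hΔ hT hrank hsha hd hrank1 hsha1
  rw [hstr] at hr
  rw [hrel] at hcount
  have ha : a ≤ 1 := by
    by_contra h
    have : 2 ^ 2 ≤ 2 ^ a := Nat.pow_le_pow_right two_pos (by omega)
    omega
  interval_cases a
  · exact Or.inl (by rw [hcount]; norm_num)
  · exact Or.inr (by rw [hcount]; norm_num)

omit [W.IsGloballyMinimal] in
/-- **`rank W(K) = 1` in the X-configuration** (`0 + 1`, Silverman Ex. 10.16). [cite: SilvermanAEC2009, Exercise 10.16] -/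
theorem mordellWeilRank_baseChange_eq_one_of_shaPlane (hrank : W.mordellWeilRank = 0) {d : ℤ} (hd : d < 0)
    (hrank1 : (W.quadraticTwist (d : ℚ)).mordellWeilRank = 1) (h2 : Module.finrank ℚ K = 2) {i : K} (hi : i ^ 2 = (d : K)) :
    (W.baseChange K).mordellWeilRank = 1 := by
  have hθ : i ∉ Set.range (algebraMap ℚ K) := by
    rintro ⟨q, hq⟩
    have hq2 : algebraMap ℚ K (q ^ 2) = algebraMap ℚ K (d : ℚ) := by rw [map_pow, hq, hi, map_intCast]
    have hq2' : q ^ 2 = (d : ℚ) := (algebraMap ℚ K).injective hq2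
    have hd' : (d : ℚ) < 0 := by exact_mod_cast hd
    nlinarith [sq_nonneg q]
  have hc' : i ^ 2 = algebraMap ℚ K (d : ℚ) := by rw [hi, map_intCast]
  rw [mordellWeilRank_baseChange_eq_add_of_sq_eq W K h2 hθ hc', hrank, hrank1]

/-- **`#Ш(W_K/K)[2] ∈ {2, 4}` in the X-configuration, unconditionally** (`#Sel₂(W_K/K) = 2·#Ш(W_K/K)[2]`, `rank W(K) = 1`).
[cite: Kramer1981, Thm. 1, Prop. 7] -/
theorem natCard_sha_two_baseChange_eq_two_or_eq_four_of_shaPlane (hΔ : 0 < W.Δ) (hT : NoRationalTwoTorsion W)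
    (hrank : W.mordellWeilRank = 0) (hsha : shaTwoCard W = 4) {d : ℤ} (hd : DescAdmissible W d)
    (hrank1 : (W.quadraticTwist (d : ℚ)).mordellWeilRank = 1) (hsha1 : shaTwoCard (W.quadraticTwist (d : ℚ)) = 1)
    (h2 : Module.finrank ℚ K = 2) {i : K} (hi : i ^ 2 = (d : K)) :
    Nat.card ((W.baseChange K).sha ⊓ AddSubgroup.torsionBy (W.baseChange K).galH1 ((2 : ℕ) : ℕ) : AddSubgroup _) = 2 ∨
      Nat.card ((W.baseChange K).sha ⊓ AddSubgroup.torsionBy (W.baseChange K).galH1 ((2 : ℕ) : ℕ) : AddSubgroup _) = 4 := by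
  have hmul := natCard_selmerGroup_baseChange_two_eq_two_mul W K hT h2
    (mordellWeilRank_baseChange_eq_one_of_shaPlane W K hrank hd.1 hrank1 h2 hi)
  rcases natCard_selmerGroup_baseChange_two_eq_four_or_eq_eight_of_shaPlane W K hΔ hT hrank hsha hd hrank1 hsha1 h2 hi with h | h <;>
    rw [h] at hmul <;> omega

/-! ## §221 Behind `h14`: `#Sel₂(W_K/K) = 8`, `#Ш(W_K/K)[2] = 4`, and DESC-28-X BY NAME -/

/-- **In the X-configuration `#Sel₂(W_K/K) = 8`, behind `h14`**: `#Sel₂(W_K/K) ∈ {4, 8}` (§220) is an odd power of `2` at a door (file 52), so `8`.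
CONDITIONAL on `h14`. [cite: Kramer1981, Thm. 1, Thm. 2] [cite: Monsky1996, Lemma 1.4(b)] -/
theorem natCard_selmerGroup_baseChange_two_eq_eight_of_shaPlane_of_monsky (h14 : Monsky1996_lemma14b_twoSelmerRank_parity)
    (hΔ : 0 < W.Δ) (hT : NoRationalTwoTorsion W) (hrank : W.mordellWeilRank = 0) (hsha : shaTwoCard W = 4)
    (h2 : Module.finrank ℚ K = 2) (hd : DescAdmissible W (NumberField.discr K))
    (hrank1 : (W.quadraticTwist ((NumberField.discr K : ℤ) : ℚ)).mordellWeilRank = 1)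
    (hsha1 : shaTwoCard (W.quadraticTwist ((NumberField.discr K : ℤ) : ℚ)) = 1) :
    Nat.card ((W.baseChange K).selmerGroup ((2 : ℕ) : ℤ)) = 8 := by
  obtain ⟨i, -, hi⟩ := exists_sq_eq_discr_not_mem_range K h2
  have hi' : i ^ 2 = ((NumberField.discr K : ℤ) : K) := by rw [hi, map_intCast]
  obtain ⟨k, hk, hk1⟩ := exists_natCard_selmerGroup_baseChange_two_eq_two_pow_odd_of_monsky W K h14 hT h2 hd
  rcases natCard_selmerGroup_baseChange_two_eq_four_or_eq_eight_of_shaPlane W K hΔ hT hrank hsha hd hrank1 hsha1 h2 hi' with h | h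
  · exfalso
    rw [hk] at h
    have hk2 : k = 2 := by
      have h4 : (2 : ℕ) ^ k = 2 ^ 2 := by rw [h]; norm_num
      exact Nat.pow_right_injective le_rfl h4
    omega
  · exact h

/-- **In the X-configuration `#Ш(W_K/K)[2] = 4`, behind `h14`.** CONDITIONAL on `h14`. [cite: Kramer1981, Thm. 1, Thm. 2] -/
theorem natCard_sha_two_baseChange_eq_four_of_shaPlane_of_monsky (h14 : Monsky1996_lemma14b_twoSelmerRank_parity)
    (hΔ : 0 < W.Δ) (hT : NoRationalTwoTorsion W) (hrank : W.mordellWeilRank = 0) (hsha : shaTwoCard W = 4)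
    (h2 : Module.finrank ℚ K = 2) (hd : DescAdmissible W (NumberField.discr K))
    (hrank1 : (W.quadraticTwist ((NumberField.discr K : ℤ) : ℚ)).mordellWeilRank = 1)
    (hsha1 : shaTwoCard (W.quadraticTwist ((NumberField.discr K : ℤ) : ℚ)) = 1) :
    Nat.card ((W.baseChange K).sha ⊓ AddSubgroup.torsionBy (W.baseChange K).galH1 ((2 : ℕ) : ℕ) : AddSubgroup _) = 4 := by
  obtain ⟨i, -, hi⟩ := exists_sq_eq_discr_not_mem_range K h2
  have hi' : i ^ 2 = ((NumberField.discr K : ℤ) : K) := by rw [hi, map_intCast]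
  have hmul := natCard_selmerGroup_baseChange_two_eq_two_mul W K hT h2
    (mordellWeilRank_baseChange_eq_one_of_shaPlane W K hrank hd.1 hrank1 h2 hi')
  rw [natCard_selmerGroup_baseChange_two_eq_eight_of_shaPlane_of_monsky W K h14 hΔ hT hrank hsha h2 hd hrank1 hsha1] at hmul
  omega

end ShaPlane

/-! ### DESC-28-X in the row's currency -/

section RowX

/-- **The `h14`-free half of DESC-28-X**: under the row's exact hypotheses (`Δ_W > 0`, `E(ℚ)[2] = 0`, `rank W = 0`, `#Ш(W)[2] = 4`, `K` a door field,
`rank W^{(d_K)} = 1`, `#Ш(W^{(d_K)})[2] = 1`) the twin's Mordell–Weil group misses the egg: `¬ MeetsEgg (doorTwist W K)`. Unconditional.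
[cite: Kramer1981, Prop. 6, Prop. 7, Thm. 1] -/
theorem not_meetsEgg_doorTwist_of_shaPlane (W : WeierstrassCurve ℚ) [W.IsElliptic] [W.IsGloballyMinimal]
    (hΔ : 0 < W.Δ) (hT : NoRationalTwoTorsion W) (hrank : W.mordellWeilRank = 0) (hsha : shaTwoCard W = 4)
    (K : Type) [Field K] [NumberField K] (hK : IsDoorField W K) (hrank1 : (doorTwist W K).mordellWeilRank = 1)
    (hsha1 : shaTwoCard (doorTwist W K) = 1) : ¬ MeetsEgg (doorTwist W K) :=
  not_meetsEgg_quadraticTwist_of_shaPlane W hΔ hT hrank hsha hK.2 hrank1 hsha1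

/-- **DESC-28-X `F1Sign2.ShaPlaneDoorTwinIdentityAtTwo` BY NAME, behind `h14`**: `Monsky1996_lemma14b_twoSelmerRank_parity → ShaPlaneDoorTwinIdentityAtTwo`
— the egg half is §220 (unconditional), the count `#Sel₂(W/K) = 8` is §221 (the parity sentence of Kramer's Thm. 1 with Thm. 2, taken as the tree's
existing named fact). CONDITIONAL on `h14`; BSD is not proved by this. [cite: Kramer1981, Thm. 1, Prop. 7, Thm. 2] [cite: Monsky1996, Lemma 1.4(b)] -/
theorem shaPlaneDoorTwinIdentityAtTwo_of_monsky (h14 : Monsky1996_lemma14b_twoSelmerRank_parity) :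
    Summit.BirchSwinnertonDyer.Rank1Residual.F1Sign2.ShaPlaneDoorTwinIdentityAtTwo := by
  intro W _ _ hΔ hT hrank hsha K _ _ hK hrank1 hsha1
  exact ⟨not_meetsEgg_quadraticTwist_of_shaPlane W hΔ hT hrank hsha hK.2 hrank1 hsha1,
    natCard_selmerGroup_baseChange_two_eq_eight_of_shaPlane_of_monsky W K h14 hΔ hT hrank hsha hK.1 hK.2 hrank1 hsha1⟩

end RowX

end Summit.BirchSwinnertonDyer.BirchSwinnertonDyer.Theorems.GenusKolyArch

end
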